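import Mathlib
import Literature.Probability.LatticeModels.TemperleyLiebSpinChain
import Literature.Probability.Percolation.DiagonalStripVertexSpecialComponent
import Literature.Probability.Percolation.DiagonalStripPairingSymmetry
import HarnessLib

/-!
# Hagendorf–Liénardy's vector: exchange relations, generation from the special component

Topic `Literature/Probability/Percolation`. The components `Ψ_a` (`vPsi`, down spins listed by `a`)
are assembled into a vector indexed by spin configurations `σ : Fin L → Bool` (`true` = down) of the
sector with `n` down spins (**`vPsiVec`**, the downs enumerated increasingly). The component exchange
relations of `DiagonalStripVertexNumerators` become the **six-vertex exchange relations**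
`Ř_{s,s+1}(z_s/z_{s+1}) Ψ(…, z_s, z_{s+1}, …) = Ψ(…, z_{s+1}, z_s, …)` (HL Prop. 3.2), written
componentwise as the predicate **`IsHLExchange`**: `[c z_t/z_s] σ_s Ψ_σ = [c z_s/z_t] Ψ_σ` if
`σ_s = σ_t` and `[c] Ψ_σ + [z_s/z_t] Ψ_{σ^{(s t)}} = [c z_t/z_s] σ_s Ψ_σ` otherwise
(**`isHLExchange_vPsiVec`**). As in HL Lemma 3.4 / Prop. 3.5, the second relation determines
`Ψ_{σ'}` for the configuration `σ'` obtained by moving a down spin one site to the right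
(`vec_move_right`), every configuration of the sector is reached from the packed one `σ⁰` by such
moves (**`sector_induction`**), hence a solution of the exchange relations is determined by its special
component (**`eq_of_isHLExchange_of_spec_eq`**, HL Prop. 3.5), and properties of the special component
compatible with the moves propagate: the components with the last site up are invariant under
`z_L ↦ 1/z_L` (**`genInv_vPsiVec_of_last_up`**, HL Prop. 3.7, Case 1 of (3.25), `s = 1`).

## References

* C. Hagendorf, J. Liénardy, *The open XXZ chain at Δ = -1/2 and the boundary quantum
  Knizhnik–Zamolodchikov equations*, J. Stat. Mech. (2021) 013104, arXiv:2008.03220, Prop. 3.2,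
  Lemmas 3.3–3.4, Prop. 3.5, Prop. 3.7. [HagendorfLienardy2021]
-/

noncomputable section

namespace Literature.Probability.Percolation

open Finset MvPolynomial Literature.Probability.LatticeModels.TemperleyLieb

variable {L n : ℕ}

/-! ### The vector -/

section Vector

variable (q : ℂ)

/-- The set of down spins of a configuration. [folklore] -/
def downSet (σ : SpinConfig L) : Finset (Fin L) := univ.filter fun j => σ j = true

/-- Membership in the set of down spins. [folklore] -/
@[simp] theorem mem_downSet {σ : SpinConfig L} {j : Fin L} : j ∈ downSet σ ↔ σ j = true := by simp [downSet]

/-- Its cardinality is the number of down spins. [folklore] -/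
theorem card_downSet (σ : SpinConfig L) : (downSet σ).card = downCount σ := rfl

/-- The increasing enumeration of the down spins. [folklore] -/
def downEnum (σ : SpinConfig L) (h : downCount σ = n) : Fin n → Fin L := fun ℓ => (downSet σ).orderEmbOfFin h ℓ

/-- The enumerated sites are down. [folklore] -/
theorem apply_downEnum (σ : SpinConfig L) (h : downCount σ = n) (ℓ : Fin n) : σ (downEnum σ h ℓ) = true :=
  mem_downSet.1 (Finset.orderEmbOfFin_mem _ h ℓ)

/-- The enumeration is strictly increasing. [folklore] -/
theorem strictMono_downEnum (σ : SpinConfig L) (h : downCount σ = n) : StrictMono (downEnum σ h) :=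
  fun _ _ hab => ((downSet σ).orderEmbOfFin h).strictMono hab

/-- The enumeration is injective. [folklore] -/
theorem downEnum_injective (σ : SpinConfig L) (h : downCount σ = n) : Function.Injective (downEnum σ h) :=
  (strictMono_downEnum σ h).injective

/-- Every down spin is enumerated. [folklore] -/
theorem exists_downEnum_eq {σ : SpinConfig L} (h : downCount σ = n) {j : Fin L} (hj : σ j = true) :
    ∃ ℓ, downEnum σ h ℓ = j := by
  have : j ∈ Set.range ((downSet σ).orderEmbOfFin h) := by
    rw [Finset.range_orderEmbOfFin]; exact mem_coe.2 (mem_downSet.2 hj)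
  exact this

/-- **Uniqueness of the enumeration**: a strictly increasing map onto down spins is the enumeration.
[folklore] -/
theorem eq_downEnum {σ : SpinConfig L} (h : downCount σ = n) {f : Fin n → Fin L} (hf : ∀ ℓ, σ (f ℓ) = true)
    (hmono : StrictMono f) : f = downEnum σ h :=
  Finset.orderEmbOfFin_unique h (fun ℓ => mem_downSet.2 (hf ℓ)) hmono

/-- **Hagendorf–Liénardy's vector** in the sector with `n` down spins: `Ψ_σ = Ψ_a` with `a` the
increasing enumeration of the down spins of `σ`, zero off the sector. [cite: HagendorfLienardy2021, (3.6)] -/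
def vPsiVec (L n : ℕ) (σ : SpinConfig L) : RapidityField ℂ :=
  if h : downCount σ = n then vPsi q L n (downEnum σ h) else 0

/-- The vector on its sector. [folklore] -/
theorem vPsiVec_of_eq {σ : SpinConfig L} (h : downCount σ = n) : vPsiVec q L n σ = vPsi q L n (downEnum σ h) := by
  unfold vPsiVec; rw [dif_pos h]

/-- The vector off its sector. [folklore] -/
theorem vPsiVec_of_ne {σ : SpinConfig L} (h : downCount σ ≠ n) : vPsiVec q L n σ = 0 := by
  unfold vPsiVec; rw [dif_neg h]

/-- **The packed configuration `σ⁰`**: down spins at the first `n` sites. [cite: HagendorfLienardy2021, Prop. 3.1] -/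
def packed (L n : ℕ) : SpinConfig L := fun j => decide (j.val < n)

/-- The packed configuration has `n` down spins (`n ≤ L`). [folklore] -/
theorem downCount_packed (h : n ≤ L) : downCount (packed L n) = n := by
  unfold downCount packed
  have : (univ.filter fun i : Fin L => decide (i.val < n) = true) = univ.map (Fin.castLEEmb h) := by
    rw [map_castLEEmb_eq_sLT]; ext i; simp
  rw [this, card_map, card_univ, Fintype.card_fin]

/-- The enumeration of the packed configuration is the initial segment. [folklore] -/
theorem downEnum_packed (h : n ≤ L) : downEnum (packed L n) (downCount_packed h) = Fin.castLE h :=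
  (eq_downEnum _ (fun ℓ => by simp [packed]) (Fin.strictMono_castLE h)).symm

/-- **The special component of the vector.** [cite: HagendorfLienardy2021, Prop. 3.1] -/
theorem vPsiVec_packed (h : n ≤ L) : vPsiVec q L n (packed L n) = vPsi q L n (Fin.castLE h) := by
  rw [vPsiVec_of_eq q (downCount_packed h), downEnum_packed h]

end Vector

/-! ### The six-vertex exchange relations, componentwise -/

section Exchange

variable (q : ℂ)

/-- **The exchange relation `Ř_{s,t}(z_s/z_t) Ψ = Ψ(…, z_t, z_s, …)` at the adjacent sites `s, t = s+1`,
componentwise** (HL (3.12) with the `Ř`-matrix (3.7)–(3.10), i.e. (3.13) and (3.16)–(3.17)):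
equal spins `[c z_t/z_s] σ_s Ψ_σ = [c z_s/z_t] Ψ_σ`, different spins
`[c] Ψ_σ + [z_s/z_t] Ψ_{σ^{(s t)}} = [c z_t/z_s] σ_s Ψ_σ`. [cite: HagendorfLienardy2021, Prop. 3.2, (3.12)] -/
def IsHLExchange (s t : Fin L) (Ψ : SpinConfig L → RapidityField ℂ) : Prop :=
  (∀ σ, σ s = σ t → qbr (genC ℂ q * zv t / zv s) * genSwap ℂ (s.val + 1) (Ψ σ) = qbr (genC ℂ q * zv s / zv t) * Ψ σ) ∧
  (∀ σ, σ s ≠ σ t → qbr (genC ℂ q) * Ψ σ + qbr (zv s / zv t) * Ψ (spinFlip s t σ) =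
    qbr (genC ℂ q * zv t / zv s) * genSwap ℂ (s.val + 1) (Ψ σ))

variable {q} (hq : q ^ 2 + q + 1 = 0) {s t : Fin L} (hst : t.val = s.val + 1)
include hst

/-- Two labels at the adjacent sites `s < t` of a strictly increasing enumeration are consecutive. [folklore] -/
theorem consecutive_of_strictMono {a : Fin n → Fin L} (hmono : StrictMono a) {ℓ ℓ' : Fin n} (hℓ : a ℓ = s) (hℓ' : a ℓ' = t) :
    ℓ'.val = ℓ.val + 1 := by
  have hlt : ℓ < ℓ' := hmono.lt_iff_lt.1 (by rw [hℓ, hℓ', Fin.lt_def]; omega)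
  by_contra hne
  have hlt2 : ℓ.val + 1 < ℓ'.val := by rw [Fin.lt_def] at hlt; omega
  set k : Fin n := ⟨ℓ.val + 1, by omega⟩
  have h1 : a ℓ < a k := hmono (show ℓ < k by simp [Fin.lt_def, k])
  have h2 : a k < a ℓ' := hmono (show k < ℓ' by simp [Fin.lt_def, k]; omega)
  rw [hℓ, Fin.lt_def] at h1; rw [hℓ', Fin.lt_def] at h2; omega

/-- Moving the down spin at `s` to the up site `t`: the new enumeration is the update. [folklore] -/
theorem downEnum_spinFlip_right {σ : SpinConfig L} (h : downCount σ = n) (hs : σ s = true) (ht : σ t = false) {ℓ : Fin n}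
    (hℓ : downEnum σ h ℓ = s) :
    downEnum (spinFlip s t σ) (by rw [downCount_spinFlip (fun h' => by rw [h'] at hs; exact absurd (hs.symm.trans ht) (by decide)) σ]; exact h) =
      Function.update (downEnum σ h) ℓ t := by
  have hne : s ≠ t := fun h' => by rw [h'] at hs; exact absurd (hs.symm.trans ht) (by decide)
  symm
  refine eq_downEnum _ (fun k => ?_) (fun k k' hkk => ?_)
  · by_cases hk : k = ℓ
    · subst hk; rw [Function.update_self, spinFlip_apply_right]; exact hs
    · rw [Function.update_of_ne hk]
      have h1 : downEnum σ h k ≠ s := fun h' => hk (downEnum_injective σ h (h'.trans hℓ.symm))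
      have h2 : downEnum σ h k ≠ t := fun h' => by have := apply_downEnum σ h k; rw [h', ht] at this; exact absurd this (by decide)
      rw [spinFlip_apply_of_ne h1 h2]; exact apply_downEnum σ h k
  · have hmono := strictMono_downEnum σ h
    by_cases hk : k = ℓ
    · subst hk
      have hk' : k' ≠ k := ne_of_gt hkk
      rw [Function.update_self, Function.update_of_ne hk']
      have h1 : downEnum σ h k < downEnum σ h k' := hmono hkk
      have h2 : downEnum σ h k' ≠ t := fun h' => by have := apply_downEnum σ h k'; rw [h', ht] at this; exact absurd this (by decide)
      rw [hℓ, Fin.lt_def] at h1; rw [Fin.lt_def]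
      have : (downEnum σ h k').val ≠ t.val := fun h' => h2 (Fin.ext h')
      omega
    · by_cases hk' : k' = ℓ
      · subst hk'
        rw [Function.update_self, Function.update_of_ne hk]
        have h1 : downEnum σ h k < downEnum σ h k' := hmono hkk
        rw [hℓ, Fin.lt_def] at h1; rw [Fin.lt_def]; omega
      · rw [Function.update_of_ne hk, Function.update_of_ne hk']; exact hmono hkk

/-- Moving the down spin at `t` to the up site `s`: the new enumeration is the update. [folklore] -/
theorem downEnum_spinFlip_left {σ : SpinConfig L} (h : downCount σ = n) (hs : σ s = false) (ht : σ t = true) {ℓ : Fin n}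
    (hℓ : downEnum σ h ℓ = t) :
    downEnum (spinFlip s t σ) (by rw [downCount_spinFlip (fun h' => by rw [h'] at hs; exact absurd (ht.symm.trans hs) (by decide)) σ]; exact h) =
      Function.update (downEnum σ h) ℓ s := by
  have hne : s ≠ t := fun h' => by rw [h'] at hs; exact absurd (ht.symm.trans hs) (by decide)
  symm
  refine eq_downEnum _ (fun k => ?_) (fun k k' hkk => ?_)
  · by_cases hk : k = ℓ
    · subst hk; rw [Function.update_self, spinFlip_apply_left hne]; exact ht
    · rw [Function.update_of_ne hk]
      have h2 : downEnum σ h k ≠ t := fun h' => hk (downEnum_injective σ h (h'.trans hℓ.symm))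
      have h1 : downEnum σ h k ≠ s := fun h' => by have := apply_downEnum σ h k; rw [h', hs] at this; exact absurd this (by decide)
      rw [spinFlip_apply_of_ne h1 h2]; exact apply_downEnum σ h k
  · have hmono := strictMono_downEnum σ h
    by_cases hk : k = ℓ
    · subst hk
      have hk' : k' ≠ k := ne_of_gt hkk
      rw [Function.update_self, Function.update_of_ne hk']
      have h1 : downEnum σ h k < downEnum σ h k' := hmono hkk
      rw [hℓ, Fin.lt_def] at h1; rw [Fin.lt_def]; omega
    · by_cases hk' : k' = ℓ
      · subst hk'
        rw [Function.update_self, Function.update_of_ne hk]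
        have h1 : downEnum σ h k < downEnum σ h k' := hmono hkk
        have h2 : downEnum σ h k ≠ s := fun h' => by have := apply_downEnum σ h k; rw [h', hs] at this; exact absurd this (by decide)
        rw [hℓ, Fin.lt_def] at h1; rw [Fin.lt_def]
        have : (downEnum σ h k).val ≠ s.val := fun h' => h2 (Fin.ext h')
        omega
      · rw [Function.update_of_ne hk, Function.update_of_ne hk']; exact hmono hkk

include hq

/-- **Hagendorf–Liénardy's vector obeys the exchange relations** at every pair of adjacent sites.
[cite: HagendorfLienardy2021, Prop. 3.2] -/
theorem isHLExchange_vPsiVec : IsHLExchange q s t (vPsiVec q L n) := by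
  have hne : s ≠ t := fun h' => by rw [h'] at hst; omega
  constructor
  · intro σ hσ
    by_cases h : downCount σ = n
    · rw [vPsiVec_of_eq q h]
      refine vPsi_exchange_same hq hst ?_
      cases hs : σ s
      · -- both up
        refine Or.inl fun ℓ => ⟨fun h' => ?_, fun h' => ?_⟩
        · have := apply_downEnum σ h ℓ; rw [h', hs] at this; exact absurd this (by decide)
        · have := apply_downEnum σ h ℓ; rw [h', ← hσ, hs] at this; exact absurd this (by decide)
      · -- both down
        obtain ⟨ℓ, hℓ⟩ := exists_downEnum_eq h hs
        obtain ⟨ℓ', hℓ'⟩ := exists_downEnum_eq h (hσ ▸ hs)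
        refine Or.inr ⟨ℓ, ℓ', consecutive_of_strictMono hst (strictMono_downEnum σ h) hℓ hℓ', hℓ, hℓ', fun k hk hk' => ⟨?_, ?_⟩⟩
        · exact fun h' => hk (downEnum_injective σ h (h'.trans hℓ.symm))
        · exact fun h' => hk' (downEnum_injective σ h (h'.trans hℓ'.symm))
    · rw [vPsiVec_of_ne q h, map_zero, mul_zero, mul_zero]
  · intro σ hσ
    by_cases h : downCount σ = n
    · have h' : downCount (spinFlip s t σ) = n := by rw [downCount_spinFlip hne]; exact h
      rw [vPsiVec_of_eq q h, vPsiVec_of_eq q h']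
      cases hs : σ s
      · -- up at `s`, down at `t`
        have ht : σ t = true := by
          cases ht : σ t
          · exact absurd (hs.trans ht.symm) hσ
          · rfl
        obtain ⟨ℓ, hℓ⟩ := exists_downEnum_eq h ht
        rw [downEnum_spinFlip_left hst h hs ht hℓ]
        refine vPsi_exchange_move_left hq hst hℓ fun k hk => ⟨fun h'' => ?_, fun h'' => hk (downEnum_injective σ h (h''.trans hℓ.symm))⟩
        have := apply_downEnum σ h k; rw [h'', hs] at this; exact absurd this (by decide)
      · -- down at `s`, up at `t`
        have ht : σ t = false := by
          cases ht : σ t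
          · rfl
          · exact absurd (hs.trans ht.symm) hσ
        obtain ⟨ℓ, hℓ⟩ := exists_downEnum_eq h hs
        rw [downEnum_spinFlip_right hst h hs ht hℓ]
        refine vPsi_exchange_move_right hq hst hℓ fun k hk => ⟨fun h'' => hk (downEnum_injective σ h (h''.trans hℓ.symm)), fun h'' => ?_⟩
        have := apply_downEnum σ h k; rw [h'', ht] at this; exact absurd this (by decide)
    · have h' : downCount (spinFlip s t σ) ≠ n := by rw [downCount_spinFlip hne]; exact h
      rw [vPsiVec_of_ne q h, vPsiVec_of_ne q h', map_zero, mul_zero, mul_zero, mul_zero, add_zero]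

omit hq in
/-- **Moving a down spin to the right determines the new component** (HL Lemma 3.4):
`[z_s/z_t] Ψ_{σ'} = [c z_t/z_s] σ_s Ψ_σ - [c] Ψ_σ` for `σ_s = ↓`, `σ_t = ↑`, `σ' = σ^{(s t)}`.
[cite: HagendorfLienardy2021, Lemma 3.4] -/
theorem vec_move_right {Ψ : SpinConfig L → RapidityField ℂ} (hΨ : IsHLExchange q s t Ψ) {σ : SpinConfig L}
    (hs : σ s = true) (ht : σ t = false) :
    qbr (zv s / zv t) * Ψ (spinFlip s t σ) = qbr (genC ℂ q * zv t / zv s) * genSwap ℂ (s.val + 1) (Ψ σ) - qbr (genC ℂ q) * Ψ σ := by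
  have _ := hst
  have h := hΨ.2 σ (by rw [hs, ht]; decide)
  linear_combination h

end Exchange

/-! ### Generation of the sector from the packed configuration -/

section Generation

/-- The excess of a configuration: the sum of the positions of its down spins. [folklore] -/
def excess (σ : SpinConfig L) : ℕ := ∑ j, if σ j = true then j.val else 0

/-- Moving a down spin from `t = s+1` to `s` lowers the excess by one. [folklore] -/
theorem excess_spinFlip {s t : Fin L} (hst : t.val = s.val + 1) {σ : SpinConfig L} (hs : σ s = false) (ht : σ t = true) :
    excess (spinFlip s t σ) + 1 = excess σ := by
  have hne : s ≠ t := fun h' => by rw [h'] at hst; omega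
  unfold excess
  rw [← Finset.add_sum_erase _ _ (mem_univ s), ← Finset.add_sum_erase _ _ (mem_erase.2 ⟨hne.symm, mem_univ t⟩),
    ← Finset.add_sum_erase univ _ (mem_univ s), ← Finset.add_sum_erase _ _ (mem_erase.2 ⟨hne.symm, mem_univ t⟩)]
  rw [spinFlip_apply_left hne, spinFlip_apply_right, hs, ht]
  have hrest : ∑ x ∈ (univ.erase s).erase t, (if spinFlip s t σ x = true then x.val else 0) =
      ∑ x ∈ (univ.erase s).erase t, (if σ x = true then x.val else 0) :=
    sum_congr rfl fun x hx => by
      rw [spinFlip_apply_of_ne (ne_of_mem_erase (mem_of_mem_erase hx)) (ne_of_mem_erase hx)]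
  rw [hrest]
  simp only [ite_true, Bool.false_eq_true, ite_false]
  omega

/-- A configuration without the pattern `↑↓` at adjacent sites is packed to the left. [folklore] -/
theorem antitone_of_no_move {σ : SpinConfig L} (hno : ∀ s t : Fin L, t.val = s.val + 1 → ¬(σ s = false ∧ σ t = true))
    {i j : Fin L} (hij : i ≤ j) (hj : σ j = true) : σ i = true := by
  obtain ⟨d, hd⟩ : ∃ d, j.val = i.val + d := ⟨j.val - i.val, by rw [Fin.le_def] at hij; omega⟩
  induction d generalizing j with
  | zero => rw [show i = j from Fin.ext (by omega)]; exact hj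
  | succ d ih =>
    set j' : Fin L := ⟨i.val + d, by omega⟩
    have hj' : σ j' = true := by
      by_contra hf
      have hf' : σ j' = false := by cases h : σ j' <;> simp_all
      exact hno j' j (by simp [j']; omega) ⟨hf', hj⟩
    exact ih (by simp [Fin.le_def, j']) hj' rfl

/-- **A configuration of the sector without the pattern `↑↓` is the packed one.** [folklore] -/
theorem eq_packed_of_no_move {σ : SpinConfig L} (h : downCount σ = n)
    (hno : ∀ s t : Fin L, t.val = s.val + 1 → ¬(σ s = false ∧ σ t = true)) : σ = packed L n := by
  have hdown : ∀ {i j : Fin L}, i ≤ j → σ j = true → σ i = true := fun hij hj => antitone_of_no_move hno hij hj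
  -- the downs form an initial segment: `σ j = true ↔ j < n`
  have key : ∀ j : Fin L, σ j = true ↔ j.val < n := by
    intro j
    constructor
    · intro hj
      -- all of `0, …, j` are down
      have hsub : (univ.filter fun i : Fin L => i.val < j.val + 1) ⊆ downSet σ := fun i hi => by
        rw [mem_downSet]; exact hdown (by rw [Fin.le_def]; have := (mem_filter.1 hi).2; omega) hj
      have hcard := card_le_card hsub
      rw [card_downSet, h] at hcard
      have : (univ.filter fun i : Fin L => i.val < j.val + 1).card = j.val + 1 := by
        have e : (univ.filter fun i : Fin L => i.val < j.val + 1) = univ.map (Fin.castLEEmb (n := j.val + 1) (by omega)) := by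
          rw [map_castLEEmb_eq_sLT]; ext i; simp
        rw [e, card_map, card_univ, Fintype.card_fin]
      omega
    · intro hj
      by_contra hnot
      -- every down is `< j`
      have hsub : downSet σ ⊆ univ.filter fun i : Fin L => i.val < j.val := fun i hi => by
        rw [mem_downSet] at hi
        refine mem_filter.2 ⟨mem_univ _, ?_⟩
        by_contra hle
        exact hnot (hdown (by rw [Fin.le_def]; omega) hi)
      have hcard := card_le_card hsub
      rw [card_downSet, h] at hcard
      have : (univ.filter fun i : Fin L => i.val < j.val).card = j.val := by
        have e : (univ.filter fun i : Fin L => i.val < j.val) = univ.map (Fin.castLEEmb (n := j.val) (by omega)) := by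
          rw [map_castLEEmb_eq_sLT]; ext i; simp
        rw [e, card_map, card_univ, Fintype.card_fin]
      omega
  funext j
  unfold packed
  by_cases hj : j.val < n
  · rw [(key j).2 hj]; simp [hj]
  · have : σ j = false := by
      rcases hσj : σ j with _ | _
      · rfl
      · exact absurd ((key j).1 hσj) hj
    rw [this]; simp [hj]

/-- **Generation of the sector** (the combinatorial content of HL Prop. 3.5: every component is
obtained from the special one by moving down spins to the right): a property of configurations with
`n` down spins that holds for the packed configuration and is preserved by moving a down spin from `s`
to the empty site `s+1` holds on the whole sector. [cite: HagendorfLienardy2021, Prop. 3.5] -/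
theorem sector_induction {P : SpinConfig L → Prop} (h0 : P (packed L n))
    (hstep : ∀ σ : SpinConfig L, ∀ s t : Fin L, t.val = s.val + 1 → downCount σ = n → σ s = true → σ t = false →
      P σ → P (spinFlip s t σ)) :
    ∀ σ : SpinConfig L, downCount σ = n → P σ := by
  suffices H : ∀ e : ℕ, ∀ σ : SpinConfig L, excess σ = e → downCount σ = n → P σ from fun σ hσ => H _ σ rfl hσ
  intro e
  induction e using Nat.strong_induction_on with
  | _ e ih =>
    intro σ he hσ
    by_cases hmove : ∃ s t : Fin L, t.val = s.val + 1 ∧ σ s = false ∧ σ t = true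
    · obtain ⟨s, t, hst, hs, ht⟩ := hmove
      have hne : s ≠ t := fun h' => by rw [h'] at hst; omega
      -- `σ = (σ⁻)^{(s t)}` with `σ⁻ = σ^{(s t)}` of smaller excess
      have hex := excess_spinFlip hst hs ht
      have hσ' : downCount (spinFlip s t σ) = n := by rw [downCount_spinFlip hne]; exact hσ
      have hP := ih (excess (spinFlip s t σ)) (by omega) _ rfl hσ'
      have := hstep (spinFlip s t σ) s t hst hσ' (by rw [spinFlip_apply_left hne]; exact ht)
        (by rw [spinFlip_apply_right]; exact hs) hP
      rwa [spinFlip_spinFlip hne] at this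
    · push Not at hmove
      rw [eq_packed_of_no_move hσ fun s t hst h' => hmove s t hst h'.1 h'.2]
      exact h0

end Generation

/-! ### Uniqueness from the special component (HL Prop. 3.5) -/

section Uniqueness

variable {q : ℂ} (hq : q ^ 2 + q + 1 = 0)
include hq

/-- **A solution of the exchange relations is determined by its special component** (on the sector):
two componentwise solutions at all adjacent pairs that agree at the packed configuration agree at every
configuration with `n` down spins. [cite: HagendorfLienardy2021, Prop. 3.5] -/
theorem eq_of_isHLExchange_of_spec_eq {Ψ Ψ' : SpinConfig L → RapidityField ℂ}
    (hΨ : ∀ s t : Fin L, t.val = s.val + 1 → IsHLExchange q s t Ψ)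
    (hΨ' : ∀ s t : Fin L, t.val = s.val + 1 → IsHLExchange q s t Ψ')
    (h0 : Ψ (packed L n) = Ψ' (packed L n)) : ∀ σ, downCount σ = n → Ψ σ = Ψ' σ := by
  refine sector_induction h0 fun σ s t hst _ hs ht hP => ?_
  have h1 := vec_move_right hst (hΨ s t hst) hs ht
  have h2 := vec_move_right hst (hΨ' s t hst) hs ht
  rw [hP] at h1
  have hx : qbr (zv s / zv t) ≠ 0 := qbr_zv_div_ne_zero (fun h' => by rw [h'] at hst; omega)
  have _ := hq
  exact mul_left_cancel₀ hx (h1.trans h2.symm)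

end Uniqueness

/-! ### The right reflection relation for the components with the last site up -/

section RightUp

variable {q : ℂ} (hq : q ^ 2 + q + 1 = 0)

/-- `genInv k` commutes with `genSwap i` when `i + 1 < k`. [folklore] -/
theorem genInv_genSwap_of_lt {i k : ℕ} (hik : i + 1 < k) (x : RapidityField ℂ) :
    genInv ℂ k (genSwap ℂ i x) = genSwap ℂ i (genInv ℂ k x) := by
  have : (genInv ℂ k).comp (genSwap ℂ i).toRingHom = (genSwap ℂ i).toRingHom.comp (genInv ℂ k) := by
    refine rapidityField_ringHom_ext (fun a => ?_) (fun n => ?_)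
    · simp [genInv_genC, genSwap_genC]
    · simp only [RingHom.comp_apply, RingEquiv.toRingHom_eq_coe, RingHom.coe_coe]
      by_cases h1 : n = i
      · subst h1
        rw [genSwap_genZ, zswap_self, genInv_genZ, Function.update_of_ne (by omega), genInv_genZ,
          Function.update_of_ne (by omega), genSwap_genZ, zswap_self]
      · by_cases h2 : n = i + 1
        · subst h2
          rw [genSwap_genZ, zswap_succ, genInv_genZ, Function.update_of_ne (by omega), genInv_genZ,
            Function.update_of_ne (by omega), genSwap_genZ, zswap_succ]
        · by_cases h3 : n = k
          · subst h3
            rw [genSwap_genZ, zswap_of_ne _ h1 h2, genInv_genZ, Function.update_self, map_inv₀, genSwap_genZ, zswap_of_ne _ h1 h2]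
          · rw [genSwap_genZ, zswap_of_ne _ h1 h2, genInv_genZ, Function.update_of_ne h3, genSwap_genZ, zswap_of_ne _ h1 h2]
  exact congrArg (fun f => f x) (congrArg DFunLike.coe this)

include hq

/-- **Right reflection, last site up** (HL (3.25) at `s = 1`): the components of the vector whose last
spin is up are invariant under `z_L ↦ 1/z_L` — the special component is (closed form), and the
invariance propagates along the moves, which never involve the last site. [cite: HagendorfLienardy2021, Prop. 3.7 (Case 1)] -/
theorem genInv_vPsiVec_of_last_up (hn : n < L) :
    ∀ σ : SpinConfig L, downCount σ = n → σ ⟨L - 1, by omega⟩ = false → genInv ℂ L (vPsiVec q L n σ) = vPsiVec q L n σ := by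
  refine sector_induction ?_ ?_
  · intro _
    rw [vPsiVec_packed q hn.le]
    exact genInv_vPsi_spec hq hn
  · intro σ s t hst hσ hs ht ih hlast
    have hne : s ≠ t := fun h' => by rw [h'] at hst; omega
    -- the move does not involve the last site
    have htL : t.val + 1 < L := by
      by_contra hcon
      have : t = ⟨L - 1, by omega⟩ := Fin.ext (by simp; omega)
      rw [← this, spinFlip_apply_right] at hlast
      rw [hlast] at hs; exact absurd hs (by decide)
    have hσL : σ ⟨L - 1, by omega⟩ = false := by
      rwa [spinFlip_apply_of_ne (fun h' => by rw [Fin.ext_iff] at h'; simp at h'; omega)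
        (fun h' => by rw [Fin.ext_iff] at h'; simp at h'; omega)] at hlast
    have ih' := ih hσL
    have hrel := vec_move_right hst (isHLExchange_vPsiVec hq hst (n := n)) hs ht
    have hx : qbr (zv s / zv t) ≠ 0 := qbr_zv_div_ne_zero hne
    apply mul_left_cancel₀ hx
    have hιs : genInv ℂ L (zv s) = zv s := genInv_zv_of_ne (by omega)
    have hιt : genInv ℂ L (zv t) = zv t := genInv_zv_of_ne (by omega)
    have := congrArg (genInv ℂ L) hrel
    simp only [map_mul, map_sub, map_qbr, map_div₀, hιs, hιt, genInv_genC] at this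
    rw [genInv_genSwap_of_lt (by omega), ih'] at this
    rw [this, hrel]

end RightUp

end Literature.Probability.Percolation
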